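import Summits.Ventures.HSemireg.WedgeHankelRecurrenceGaussChebyshevUResultantClosed

/-!
# Venture HSemireg — **THE RESULTANT OF TWO FIRST-KIND CHEBYSHEV POLYNOMIALS IN CLOSED FORM: `Res_{(m,n)}(T_m, T_n) = 0` IF `m ∕ gcd`, `n ∕ gcd` ARE BOTH ODD, AND
# `= (−1)^{mn∕2} 2^{mn + gcd(m,n) − m − n} = (−1)^{mn∕2} 2^{(m−1)(n−1) + gcd − 1}` OTHERWISE** (Mathlib's `T`, integer resultant with formal degrees `m`, `n`; Dilcher–Stolarsky); the engine
# is the pair of EUCLIDEAN STEPS FOR RESULTANTS along the `T`-recurrence `T_{j+2m} + T_j = 2 T_m T_{j+m}`: **`Res_{(m, j+2m)}(T_m, T_{j+2m}) = (−1)^m 4^{m(m−1)} Res_{(m,j)}(T_m, T_j)`** and the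
# REFLECTION **`Res_{(m, 2m−j)}(T_m, T_{2m−j}) = (−1)^m 4^{(m−1)(m−j)} Res_{(m,j)}(T_m, T_j)`** (`Res(f, g + f p) = Res(f, g)`, degree padding by powers of the top coefficient `2^{m−1}`, `Res(f, −g) =
# (−1)^{deg f} Res(f,g)`), then the descent of N458 with its parity bookkeeping (`|Res(T_m, T_n)| = 2^{(m−1)(n−1)+gcd−1}` exactly when the `m`- and `n`-node first-kind Gauss–Chebyshev rules
# share no node)

HONEST FRAMING. Part of the Lean index of the computation cell `pub-hsemireg` (seat p10 gen 48, Sunday typer «UNIFORM-IN-n»).  Polynomial ∕ resultant algebra over `ℤ` and `ℕ`-parity bookkeeping only;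
no variety, no cohomology theory, no sheaf, no Ext group and no semiregularity map is constructed here; nothing here says that HC / HC_CM / HC_AV holds; no Literature fact (unproved `Prop`) is
declared or used.  Custodian versions as in `WedgeHankelSiegelIdeal` (1/3).
SOURCES (cited).  K. Dilcher, K. B. Stolarsky, *Resultants and discriminants of Chebyshev and related polynomials*, Trans. Amer. Math. Soc. 357 (2005) 965–981, Thm 3.3 (`Res(T_m, T_n)`); D. P. Jacobs,
M. O. Rayes, V. Trevisan, *The resultant of Chebyshev polynomials*, Canad. Math. Bull. 54 (2011) 288–296; S. Louboutin, *Resultants of Chebyshev polynomials: a short proof*, Canad. Math. Bull. 56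
(2013) 602–605.  The sign `(−1)^{mn∕2}` and the exponent were checked against exact Sylvester determinants for `1 ≤ m, n ≤ 8` (seat folder `work/py/rescheck.py`).
PROOF TYPED HERE.  Mathlib `Polynomial.Chebyshev.T_mul_T`, `T_neg`, `resultant_add_mul_right`, `resultant_add_right_deg`, `resultant_C_mul_right`, `resultant_comm`, `resultant_self_eq_zero`,
`resultant_one_left ∕ _right`, `natDegree_T`; N406 `chebyshevT_natDegree_coeff`; N458 `gcd_eq_and_odd_div_iff_of_eq_add ∕ _of_add_eq`; `Nat.strong_induction_on`.
DEDUP DISCLOSURE (`rg -n 'add_le_mul_add_gcd|even_mul_of_not_odd_odd|chebyshevT_resultant_of_rel|chebyshevT_resultant_add_two_mul|chebyshevT_resultant_reflect|chebyshevT_resultant_closed' Summits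
Literature HarnessLib`, 2026-09-04): N406 `chebyshevT_resultant` (consecutive pair), N421 (two apart), N433 `chebyshevT_resultant_T_mul` ∕ `_T_two_mul` (multiples), N434 ∕ N455 (vanishing
families), N459 `chebyshevT_resultant_eq_zero_iff`; 0 hits for the 7 names below.

WHAT IS IN THE TREE.  N406, N421, N433, N434, N455, N458, N459, N460.
THIS FILE (namespace `Summit.Ventures.HSemireg.Wedge.HankelOuter` continued; CHAINED on N460; 0 definitions):
* §1226 `add_le_mul_add_gcd`, `even_mul_of_not_odd_odd` (bookkeeping), `chebyshevT_resultant_of_rel`, **`chebyshevT_resultant_add_two_mul`**, **`chebyshevT_resultant_reflect`** (the two Euclidean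
  steps), `chebyshevT_resultant_closed_descent`, **`chebyshevT_resultant_closed`**, `chebyshevT_resultant_natAbs`.
CAVEATS.  `mn ∕ 2` is `ℕ`-division (exact whenever the resultant is non-zero); `mn + gcd − m − n` is `ℕ`-subtraction without truncation (`m + n ≤ mn + gcd` always, `add_le_mul_add_gcd`).
Formal degrees explicit.  Nothing Ext-side.  New names only.
-/

open Module Polynomial
open scoped Matrix Polynomial

namespace Summit.Ventures.HSemireg.Wedge.HankelOuter

/-! ## §1226. `Res(T_m, T_n)` in closed form -/

/-- Bookkeeping: `m + n ≤ mn + gcd(m,n)` (so the exponent `mn + gcd − m − n = (m−1)(n−1) + gcd − 1` involves no truncated subtraction). [this file, §1226] -/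
theorem add_le_mul_add_gcd (m n : ℕ) : m + n ≤ m * n + Nat.gcd m n := by
  rcases Nat.eq_zero_or_pos m with rfl | hm
  · simp
  rcases Nat.eq_zero_or_pos n with rfl | hn
  · simp
  have hg : 1 ≤ Nat.gcd m n := Nat.gcd_pos_of_pos_left n hm
  nlinarith

/-- Bookkeeping: unless `m ∕ gcd` and `n ∕ gcd` are both odd, `mn` is even. [this file, §1226] -/
theorem even_mul_of_not_odd_odd {m n : ℕ} (h : ¬ (Odd (m / Nat.gcd m n) ∧ Odd (n / Nat.gcd m n))) : Even (m * n) := by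
  by_contra hodd
  rw [Nat.not_even_iff_odd, Nat.odd_mul] at hodd
  apply h
  have hg : Odd (Nat.gcd m n) := Odd.of_dvd_nat hodd.1 (Nat.gcd_dvd_left m n)
  have hm : Odd (Nat.gcd m n * (m / Nat.gcd m n)) := by rw [Nat.mul_div_cancel' (Nat.gcd_dvd_left m n)]; exact hodd.1
  have hn : Odd (Nat.gcd m n * (n / Nat.gcd m n)) := by rw [Nat.mul_div_cancel' (Nat.gcd_dvd_right m n)]; exact hodd.2
  exact ⟨(Nat.odd_mul.1 hm).2, (Nat.odd_mul.1 hn).2⟩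

/-- The resultant bookkeeping behind both Euclidean steps: if `T_n = −T_j + T_{m+1}·(2 T_i)` with `i + (m+1) ≤ n = j + k`, then `Res_{(m+1,n)}(T_{m+1}, T_n) = (−1)^{m+1} (2^m)^k
Res_{(m+1,j)}(T_{m+1}, T_j)` (remove the multiple of `T_{m+1}`, shrink the formal degree by `k` at the cost of the top coefficient `2^m`, pull out the sign). [this file, §1226] -/
theorem chebyshevT_resultant_of_rel {m j i n k : ℕ}
    (hrel : Polynomial.Chebyshev.T ℤ (n : ℤ) = -Polynomial.Chebyshev.T ℤ (j : ℤ) + Polynomial.Chebyshev.T ℤ ((m + 1 : ℕ) : ℤ) * (2 * Polynomial.Chebyshev.T ℤ (i : ℤ)))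
    (hdeg : i + (m + 1) ≤ n) (hk : n = j + k) :
    (Polynomial.Chebyshev.T ℤ ((m + 1 : ℕ) : ℤ)).resultant (Polynomial.Chebyshev.T ℤ (n : ℤ)) (m + 1) n =
      (-1) ^ (m + 1) * (2 ^ m) ^ k * (Polynomial.Chebyshev.T ℤ ((m + 1 : ℕ) : ℤ)).resultant (Polynomial.Chebyshev.T ℤ (j : ℤ)) (m + 1) j := by
  obtain ⟨hdegT, hcoeff⟩ := chebyshevT_natDegree_coeff m
  rw [show (m : ℤ) + 1 = ((m + 1 : ℕ) : ℤ) by push_cast; ring] at hdegT hcoeff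
  have hf : (Polynomial.Chebyshev.T ℤ ((m + 1 : ℕ) : ℤ)).natDegree ≤ m + 1 := hdegT.le
  have hp : (2 * Polynomial.Chebyshev.T ℤ (i : ℤ)).natDegree + (m + 1) ≤ n := by
    refine le_trans (Nat.add_le_add_right (Polynomial.natDegree_mul_le.trans ?_) _) hdeg
    rw [show (2 : ℤ[X]) = C 2 from (Polynomial.C_ofNat 2).symm, natDegree_C, zero_add, Polynomial.Chebyshev.natDegree_T, Int.natAbs_natCast]
  have hg : (-Polynomial.Chebyshev.T ℤ (j : ℤ)).natDegree ≤ j := by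
    rw [natDegree_neg, Polynomial.Chebyshev.natDegree_T, Int.natAbs_natCast]
  rw [hrel, Polynomial.resultant_add_mul_right _ _ _ _ _ hp hf, hk, Polynomial.resultant_add_right_deg _ _ _ _ k hg, hcoeff,
    show -Polynomial.Chebyshev.T ℤ (j : ℤ) = C (-1 : ℤ) * Polynomial.Chebyshev.T ℤ (j : ℤ) by rw [C_neg, C_1, neg_one_mul], Polynomial.resultant_C_mul_right]
  ring

/-- **EUCLIDEAN STEP I: `Res_{(m+1, j+2(m+1))}(T_{m+1}, T_{j+2(m+1)}) = (−1)^{m+1} (2^m)^{2(m+1)} · Res_{(m+1, j)}(T_{m+1}, T_j)`** over `ℤ` (from `T_{j+2m'} + T_j = 2 T_{m'} T_{j+m'}`).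
[Jacobs–Rayes–Trevisan 2011; this file, §1226] -/
theorem chebyshevT_resultant_add_two_mul (m j : ℕ) :
    (Polynomial.Chebyshev.T ℤ ((m + 1 : ℕ) : ℤ)).resultant (Polynomial.Chebyshev.T ℤ ((j + 2 * (m + 1) : ℕ) : ℤ)) (m + 1) (j + 2 * (m + 1)) =
      (-1) ^ (m + 1) * (2 ^ m) ^ (2 * (m + 1)) * (Polynomial.Chebyshev.T ℤ ((m + 1 : ℕ) : ℤ)).resultant (Polynomial.Chebyshev.T ℤ (j : ℤ)) (m + 1) j := by
  refine chebyshevT_resultant_of_rel (i := j + (m + 1)) ?_ (by omega) rfl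
  have h := Polynomial.Chebyshev.T_mul_T ℤ ((m + 1 : ℕ) : ℤ) ((j + (m + 1) : ℕ) : ℤ)
  rw [show ((m + 1 : ℕ) : ℤ) + ((j + (m + 1) : ℕ) : ℤ) = ((j + 2 * (m + 1) : ℕ) : ℤ) by push_cast; ring,
    show ((m + 1 : ℕ) : ℤ) - ((j + (m + 1) : ℕ) : ℤ) = -(j : ℤ) by push_cast; ring, Polynomial.Chebyshev.T_neg] at h
  linear_combination (-1 : ℤ[X]) * h

/-- **EUCLIDEAN STEP II (REFLECTION): for `j + i = m+1`, `Res_{(m+1, j+2i)}(T_{m+1}, T_{j+2i}) = (−1)^{m+1} (2^m)^{2i} · Res_{(m+1, j)}(T_{m+1}, T_j)`** over `ℤ` (here `j + 2i = 2(m+1) − j`;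
from `T_{2m'−j} + T_j = 2 T_{m'} T_{m'−j}`). [this file, §1226] -/
theorem chebyshevT_resultant_reflect {m j i : ℕ} (hji : j + i = m + 1) :
    (Polynomial.Chebyshev.T ℤ ((m + 1 : ℕ) : ℤ)).resultant (Polynomial.Chebyshev.T ℤ ((j + 2 * i : ℕ) : ℤ)) (m + 1) (j + 2 * i) =
      (-1) ^ (m + 1) * (2 ^ m) ^ (2 * i) * (Polynomial.Chebyshev.T ℤ ((m + 1 : ℕ) : ℤ)).resultant (Polynomial.Chebyshev.T ℤ (j : ℤ)) (m + 1) j := by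
  refine chebyshevT_resultant_of_rel (i := i) ?_ (by omega) rfl
  have h := Polynomial.Chebyshev.T_mul_T ℤ ((m + 1 : ℕ) : ℤ) (i : ℤ)
  rw [show ((m + 1 : ℕ) : ℤ) + (i : ℤ) = ((j + 2 * i : ℕ) : ℤ) by push_cast; linarith,
    show ((m + 1 : ℕ) : ℤ) - (i : ℤ) = (j : ℤ) by push_cast; linarith] at h
  linear_combination (-1 : ℤ[X]) * h

/-- The descent: for `1 ≤ m < n`, the closed form at all `(m, j)` with `j < n` gives it at `(m, n)` (fold `n` modulo `2m`, Euclidean step I or II, bookkeeping of N458). [this file, §1226] -/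
theorem chebyshevT_resultant_closed_descent {m n : ℕ} (hm : 0 < m) (hmn : m < n)
    (ih : ∀ j < n, (Polynomial.Chebyshev.T ℤ (m : ℤ)).resultant (Polynomial.Chebyshev.T ℤ (j : ℤ)) m j =
      if Odd (m / Nat.gcd m j) ∧ Odd (j / Nat.gcd m j) then 0 else (-1) ^ (m * j / 2) * 2 ^ (m * j + Nat.gcd m j - m - j)) :
    (Polynomial.Chebyshev.T ℤ (m : ℤ)).resultant (Polynomial.Chebyshev.T ℤ (n : ℤ)) m n =
      if Odd (m / Nat.gcd m n) ∧ Odd (n / Nat.gcd m n) then 0 else (-1) ^ (m * n / 2) * 2 ^ (m * n + Nat.gcd m n - m - n) := by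
  obtain ⟨m, rfl⟩ : ∃ m', m = m' + 1 := ⟨m - 1, by omega⟩
  rcases Nat.lt_or_ge n (2 * (m + 1)) with h2 | h2
  · -- Euclidean step II: `n + j = 2(m+1)`, `n = j + 2i`, `j + i = m + 1`
    obtain ⟨i, j, rfl, hji⟩ : ∃ i j, n = j + 2 * i ∧ j + i = m + 1 := ⟨n - (m + 1), 2 * (m + 1) - n, by omega, by omega⟩
    obtain ⟨hg, hodd⟩ := gcd_eq_and_odd_div_iff_of_add_eq (m := m + 1) (n := j + 2 * i) (j := j) (q := 1) (by omega)
    rw [chebyshevT_resultant_reflect hji, ih j (by omega), hg]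
    by_cases hP : Odd ((m + 1) / Nat.gcd (m + 1) j) ∧ Odd (j / Nat.gcd (m + 1) j)
    · rw [if_pos hP, if_pos (show _ ∧ _ from ⟨hP.1, hodd.2 hP.2⟩), mul_zero]
    · rw [if_neg hP, if_neg (fun h => hP ⟨h.1, hodd.1 h.2⟩)]
      have hev : Even ((m + 1) * j) := even_mul_of_not_odd_odd hP
      have hdiv : (m + 1) * (j + 2 * i) / 2 = (m + 1) * j / 2 + (m + 1) * i := by
        rw [show (m + 1) * (j + 2 * i) = (m + 1) * j + 2 * ((m + 1) * i) by ring, Nat.add_mul_div_left _ _ (by norm_num : 0 < 2)]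
      have hexp : (m + 1) * (j + 2 * i) + Nat.gcd (m + 1) j - (m + 1) - (j + 2 * i) = ((m + 1) * j + Nat.gcd (m + 1) j - (m + 1) - j) + m * (2 * i) := by
        have h1 := add_le_mul_add_gcd (m + 1) j
        have h2 : (m + 1) * (j + 2 * i) = (m + 1) * j + m * (2 * i) + 2 * i := by ring
        omega
      have hsgn : ((-1 : ℤ)) ^ ((m + 1) * i) = (-1) ^ (m + 1) := by
        rcases Nat.even_or_odd (m + 1) with h | h
        · rw [Even.neg_one_pow h, Even.neg_one_pow (h.mul_right _)]
        · have hj : Even j := ((Nat.even_mul.1 hev).resolve_left (Nat.not_even_iff_odd.2 h))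
          have hi : Odd i := by
            by_contra hi
            rw [Nat.not_odd_iff_even] at hi
            exact (Nat.not_even_iff_odd.2 h) (hji ▸ hj.add hi)
          rw [Odd.neg_one_pow h, Odd.neg_one_pow (h.mul hi)]
      rw [hdiv, hexp, pow_add, pow_add, ← pow_mul, hsgn]
      ring
  · -- Euclidean step I: `n = j + 2(m+1)`
    obtain ⟨j, rfl⟩ : ∃ j, n = j + 2 * (m + 1) := ⟨n - 2 * (m + 1), by omega⟩
    obtain ⟨hg, hodd⟩ := gcd_eq_and_odd_div_iff_of_eq_add (m := m + 1) (n := j + 2 * (m + 1)) (j := j) (q := 1) (by ring)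
    rw [chebyshevT_resultant_add_two_mul, ih j (by omega), hg]
    by_cases hP : Odd ((m + 1) / Nat.gcd (m + 1) j) ∧ Odd (j / Nat.gcd (m + 1) j)
    · rw [if_pos hP, if_pos (show _ ∧ _ from ⟨hP.1, hodd.2 hP.2⟩), mul_zero]
    · rw [if_neg hP, if_neg (fun h => hP ⟨h.1, hodd.1 h.2⟩)]
      have hdiv : (m + 1) * (j + 2 * (m + 1)) / 2 = (m + 1) * j / 2 + (m + 1) * (m + 1) := by
        rw [show (m + 1) * (j + 2 * (m + 1)) = (m + 1) * j + 2 * ((m + 1) * (m + 1)) by ring, Nat.add_mul_div_left _ _ (by norm_num : 0 < 2)]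
      have hexp : (m + 1) * (j + 2 * (m + 1)) + Nat.gcd (m + 1) j - (m + 1) - (j + 2 * (m + 1)) = ((m + 1) * j + Nat.gcd (m + 1) j - (m + 1) - j) + m * (2 * (m + 1)) := by
        have h1 := add_le_mul_add_gcd (m + 1) j
        have h2 : (m + 1) * (j + 2 * (m + 1)) = (m + 1) * j + m * (2 * (m + 1)) + 2 * (m + 1) := by ring
        omega
      have hsgn : ((-1 : ℤ)) ^ ((m + 1) * (m + 1)) = (-1) ^ (m + 1) := by
        rcases Nat.even_or_odd (m + 1) with h | h
        · rw [Even.neg_one_pow h, Even.neg_one_pow (h.mul_right _)]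
        · rw [Odd.neg_one_pow h, Odd.neg_one_pow (h.mul h)]
      rw [hdiv, hexp, pow_add, pow_add, ← pow_mul, hsgn]
      ring

/-- **`Res_{(m,n)}(T_m, T_n) = 0` if `m ∕ gcd(m,n)` and `n ∕ gcd(m,n)` are both odd, and `= (−1)^{mn∕2} · 2^{mn + gcd(m,n) − m − n}` otherwise** (all `m, n ∈ ℕ`; integer resultant of
Mathlib's `T` with formal degrees `m`, `n`). [Dilcher–Stolarsky 2005 Thm 3.3; Jacobs–Rayes–Trevisan 2011; Louboutin 2013; this file, §1226] -/
theorem chebyshevT_resultant_closed (m n : ℕ) :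
    (Polynomial.Chebyshev.T ℤ (m : ℤ)).resultant (Polynomial.Chebyshev.T ℤ (n : ℤ)) m n =
      if Odd (m / Nat.gcd m n) ∧ Odd (n / Nat.gcd m n) then 0 else (-1) ^ (m * n / 2) * 2 ^ (m * n + Nat.gcd m n - m - n) := by
  obtain ⟨s, hs⟩ : ∃ s, m + n = s := ⟨_, rfl⟩
  induction s using Nat.strong_induction_on generalizing m n with
  | _ s ih =>
  rcases Nat.eq_zero_or_pos m with rfl | hm
  · rw [Nat.cast_zero, Polynomial.Chebyshev.T_zero]
    simp
  rcases Nat.eq_zero_or_pos n with rfl | hn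
  · rw [Nat.cast_zero, Polynomial.Chebyshev.T_zero]
    simp
  rcases lt_trichotomy m n with hlt | rfl | hgt
  · exact chebyshevT_resultant_closed_descent hm hlt (fun j _ => ih (m + j) (by omega) m j rfl)
  · have h0 := Polynomial.resultant_self_eq_zero (Polynomial.Chebyshev.T ℤ (m : ℤ)) (by rw [Polynomial.Chebyshev.natDegree_T, Int.natAbs_natCast]; omega)
    rw [Polynomial.Chebyshev.natDegree_T, Int.natAbs_natCast] at h0
    rw [h0, Nat.gcd_self, Nat.div_self hm, if_pos ⟨odd_one, odd_one⟩]
  · rw [Polynomial.resultant_comm, chebyshevT_resultant_closed_descent hn hgt (fun j _ => ih (n + j) (by omega) n j rfl), Nat.gcd_comm n m]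
    by_cases hP : Odd (m / Nat.gcd m n) ∧ Odd (n / Nat.gcd m n)
    · rw [if_pos hP, if_pos (show _ ∧ _ from ⟨hP.2, hP.1⟩), mul_zero]
    · rw [if_neg hP, if_neg (fun h => hP ⟨h.2, h.1⟩), mul_comm n m, Even.neg_one_pow (even_mul_of_not_odd_odd hP), one_mul, Nat.sub_sub, Nat.sub_sub, Nat.add_comm n m]

/-- **`|Res_{(m,n)}(T_m, T_n)| = 2^{mn + gcd − m − n}` unless `m ∕ gcd`, `n ∕ gcd` are both odd (then `0`).** [Dilcher–Stolarsky 2005; this file, §1226] -/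
theorem chebyshevT_resultant_natAbs (m n : ℕ) :
    ((Polynomial.Chebyshev.T ℤ (m : ℤ)).resultant (Polynomial.Chebyshev.T ℤ (n : ℤ)) m n).natAbs =
      if Odd (m / Nat.gcd m n) ∧ Odd (n / Nat.gcd m n) then 0 else 2 ^ (m * n + Nat.gcd m n - m - n) := by
  rw [chebyshevT_resultant_closed]
  split_ifs
  · rfl
  · rw [Int.natAbs_mul, Int.natAbs_pow, Int.natAbs_neg, Int.natAbs_one, one_pow, one_mul, Int.natAbs_pow]
    rfl

end Summit.Ventures.HSemireg.Wedge.HankelOuter
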